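import Summits.KontsevichZagierPeriods.KontsevichZagierPeriods.Theorems.RootDecompRationalCubeDichotomyRankDescentP18

/-! # `RootDecompRationalCubeDichotomyRankDescentP19` — part 5/9 of the mechanical ≤400-line split of `RankDescent_delta_v12_to_v14h_P15plus.lean` (sha256 311877f354eea7b0…)
Source: decomp-kz lens-2 g15 RankDescent_delta_v12_to_v14h_P15plus.lean @311877f3 (critic CLEARED g7-6 l.1400: 26322 ⟺ LetterDegenerateKernel, GenericKernel THEOREM); --supports stmt-KontsevichZagierPeriods-26322.
Split by census-1 g10 `gen/splitlean.py`: scopes re-opened with their `open`/`variable`/`set_option` context; mathematics and declaration order unchanged. -/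

noncomputable section
open MeasureTheory Set MvPolynomial
open Literature.NumberTheory.Transcendental
open Literature.NumberTheory.Transcendental.KZ
namespace Summit.KontsevichZagierPeriods.RootDecompRationalCubeDichotomy.Rung26322.RankDescent
variable {M : ℕ}
open MeasureTheory Set MvPolynomial in
open Literature.NumberTheory.Transcendental in
open Literature.NumberTheory.Transcendental.KZ in
open MeasureTheory Set MvPolynomial in
open Literature.NumberTheory.Transcendental in
open Literature.NumberTheory.Transcendental.KZ in
/-- Soundness: congruent formal combinations have equal values. (cite KontsevichZagier2001, §1.2) -/
private theorem eval_eq_of_sub_mem {x y : FormalRep} (h : x - y ∈ relations) : eval x = eval y := by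
  have h' := relations_le_ker_eval_holds h
  rw [AddMonoidHom.mem_ker, map_sub] at h'
  exact sub_eq_zero.1 h'

section LetterCriterion
variable {k : ℕ}

/-- **The generic piece with `N = 0`, PROVED.** (cite KontsevichZagier2001, §1.2) -/
theorem generic_mem_relations {m : ℕ} (q : IntegralRep m) (P Q : MvPolynomial (Fin m) ℚ)
    (hg : IsGeneric Q) (hd : q.domain = Set.pi Set.univ (fun _ : Fin m => Set.Icc (0:ℝ) 1))
    (hQ : ∀ z ∈ Set.pi Set.univ (fun _ : Fin m => Set.Icc (0:ℝ) 1), MvPolynomial.aeval z Q ≠ 0)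
    (hf : ∀ z ∈ Set.pi Set.univ (fun _ : Fin m => Set.Icc (0:ℝ) 1),
      q.integrand z = MvPolynomial.aeval z P / MvPolynomial.aeval z Q)
    (h0 : q.value = 0) : of q ∈ relations := by
  obtain ⟨D, hz, hfc, hQD, hgen⟩ := hg
  have hqT := of_sub_cubeRFun_mem q P Q hd hQ hf
  have hval : (cubeRFun P Q hQ).rep.value = 0 := by
    rw [← eval_of, ← eval_eq_of_sub_mem hqT, eval_of, h0]
  have hT := rep_mem_relations_of_generic D hz hfc hgen (cubeRFun P Q hQ) hQD hval
  have : of q = (of q - of (cubeRFun P Q hQ).rep) + of (cubeRFun P Q hQ).rep := by abel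
  rw [this]
  exact add_mem hqT hT

/-- **THEOREM: `GenericKernel` holds** (`N = 0`). (cite KontsevichZagier2001, §1.2) -/
theorem genericKernel_holds : GenericKernel :=
  fun _ q P Q hg hd hQ hf h0 => ⟨0, generic_mem_relations q P Q hg hd hQ hf h0⟩

/-- **Exhaustion (excluded middle on `IsGeneric Q`).** [folklore] -/
theorem single_of_generic_special (hG : GenericKernel) (hS : SpecialKernel) :
    Summit.KontsevichZagierPeriods.KontsevichZagierPeriods.Theses.RootDecompRationalCubeDichotomy.RationalCubePiKernelSingle := by
  intro m q P Q hd hQ hf h0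
  by_cases h : IsGeneric Q
  · exact hG m q P Q h hd hQ hf h0
  · exact hS m q P Q h hd hQ hf h0

/-- **THE NODE, by name: crux 26322 ⟸ its special (letter-dependent) piece alone.**
(cite KontsevichZagier2001, §1.2) -/
theorem rationalCubePiKernelSingle_of_special (hS : SpecialKernel) :
    Summit.KontsevichZagierPeriods.KontsevichZagierPeriods.Theses.RootDecompRationalCubeDichotomy.RationalCubePiKernelSingle :=
  single_of_generic_special genericKernel_holds hS

/-- The special piece is implied by the crux (drop the hypothesis): it is the WEAKER side. [folklore] -/
theorem special_of_single
    (h : Summit.KontsevichZagierPeriods.KontsevichZagierPeriods.Theses.RootDecompRationalCubeDichotomy.RationalCubePiKernelSingle) :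
    SpecialKernel :=
  fun m q P Q _ hd hQ hf h0 => h m q P Q hd hQ hf h0

/-- The generic piece is (also, trivially) implied by the crux. [folklore] -/
theorem generic_of_single
    (h : Summit.KontsevichZagierPeriods.KontsevichZagierPeriods.Theses.RootDecompRationalCubeDichotomy.RationalCubePiKernelSingle) :
    GenericKernel :=
  fun m q P Q _ hd hQ hf h0 => h m q P Q hd hQ hf h0

/-! ### INSTANCE: the tower system of `q₀ + x₀⋯x_{k-1}` (§17 re-derived from THEOREM U, and sharpened) -/

section TowerInstance

variable {n : ℕ} (q₀ : ℚ) (hq : 0 < q₀ ∨ q₀ < -1)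

/-- THE TOWER SYSTEM of `q₀` up to dimension `n`: the tower denominators `q₀ + x₀⋯x_{k-1}` (`k ≤ n`)
and the non-zero rational constants (the `x_j = 0` faces). (folklore) -/
def towerSys (n : ℕ) (k : ℕ) : Set (MvPolynomial (Fin k) ℚ) :=
  {F | (k ≤ n ∧ F = fhQ k q₀) ∨ ∃ u : ℚ, u ≠ 0 ∧ F = C u}

include hq in
/-- Auxiliary step `q₀_ne_zero_rat`: q₀ ne zero rat. [bookkeeping] -/
theorem q₀_ne_zero_rat : q₀ ≠ 0 := by
  rcases hq with h | h
  · exact h.ne'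
  · exact (lt_trans h (by norm_num : (-1 : ℚ) < 0)).ne

include hq in
/-- The tower system is zero-free on the closed cubes. [folklore] -/
theorem zeroFree_towerSys : ZeroFree (towerSys q₀ n) := by
  rintro k F (⟨-, rfl⟩ | ⟨u, hu, rfl⟩) x hx
  · exact fhQ_ne_zero_of q₀ hq x hx
  · rw [MvPolynomial.aeval_C, eq_ratCast]; exact_mod_cast hu

/-- The faces of the tower denominator: `(q₀ + x₀⋯x_k)|_{x_j := c} = q₀ + c·x₀⋯x_{k-1}`. [folklore] -/
theorem bind₁_insX_fhQ {k : ℕ} (j : Fin (k + 1)) (c : ℚ) :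
    bind₁ (insX j c) (fhQ (k + 1) q₀) = C q₀ + C c * ∏ i : Fin k, X i := by
  rw [fhQ_eq, map_add, bind₁_C_right, map_prod, Fin.prod_univ_succAbove _ j]
  simp only [bind₁_X_right, insX, Fin.insertNth_apply_same, Fin.insertNth_apply_succAbove]

include hq in
/-- The tower system is face-closed. [folklore] -/
theorem faceClosed_towerSys : FaceClosed (towerSys q₀ n) := by
  rintro k F (⟨hk, rfl⟩ | ⟨u, hu, rfl⟩) j c hc
  · rw [bind₁_insX_fhQ]
    rcases hc with rfl | rfl
    · exact Or.inr ⟨q₀, q₀_ne_zero_rat q₀ hq, by rw [C_0, zero_mul, add_zero]⟩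
    · exact Or.inl ⟨Nat.le_of_succ_le hk, by rw [C_1, one_mul, fhQ_eq]⟩
  · exact Or.inr ⟨u, hu, by rw [bind₁_C_right]⟩

/-- `ℚ + ℚ·L_1(q₀) + ⋯ + ℚ·L_k(q₀)` as a `ℚ`-submodule of `ℝ`. (folklore) -/
def inSpanSub (k : ℕ) : Submodule ℚ ℝ where
  carrier := {v | InSpan q₀ hq k v}
  zero_mem' := by simpa using inSpan_rat q₀ hq (n := k) 0
  add_mem' := fun ha hb => ha.add q₀ hq hb
  smul_mem' := fun a v hv => by
    show InSpan q₀ hq k (a • v)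
    rw [Rat.smul_def]
    exact InSpan.smul q₀ hq a hv

/-- Auxiliary step `mono_le`: mono le. [bookkeeping] -/
theorem InSpan.mono_le {j k : ℕ} (hjk : j ≤ k) {v : ℝ} (hv : InSpan q₀ hq j v) : InSpan q₀ hq k v := by
  induction hjk with
  | refl => exact hv
  | step _ ih => exact ih.mono q₀ hq

/-- Every value of dimension `≤ k` over the tower system lies in `ℚ + Σ_{j ≤ k} ℚ·L_j(q₀)`
(THEOREM A of §17 for the towers; rationality of `∫ P/u` for the constants). [folklore] -/
theorem VSpan_towerSys_le (k : ℕ) : VSpan (towerSys q₀ n) k ≤ inSpanSub q₀ hq k := by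
  rw [VSpan, Submodule.span_le]
  rintro v ⟨j, P, F, hjk, hF, rfl⟩
  show InSpan q₀ hq k (cubeVal j P F)
  rcases hF with ⟨-, rfl⟩ | ⟨u, hu, rfl⟩
  · exact InSpan.mono_le q₀ hq hjk (fhV_inSpan q₀ hq j P)
  · have hz : ∀ x ∈ KZ.cube j, aeval x (C u : MvPolynomial (Fin j) ℚ) ≠ 0 := fun x _ => by
      rw [MvPolynomial.aeval_C, eq_ratCast]; exact_mod_cast hu
    obtain ⟨r, hr⟩ := exists_rat_value_of_den_C (⟨P, C u, hz⟩ : RFun j) rfl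
    have : cubeVal j P (C u) = (⟨P, C u, hz⟩ : RFun j).rep.value := rfl
    rw [this, hr]
    exact InSpan.mono_le q₀ hq hjk (inSpan_rat q₀ hq r)

include hq in
/-- **The tower system is letter-generic at level `k+1` as soon as the top letter is NEW**,
`L_{k+1}(q₀) ∉ ℚ + ℚ·L_1(q₀) + ⋯ + ℚ·L_k(q₀)`: ONE letter `1/(q₀ + x₀⋯x_k)`, SPAN = §9
(`P ≡ Λ(P)·1 mod Ex0m`), INDEP = `TopLetterNew`. [folklore] -/
theorem genAt_towerSys {k : ℕ} (hN : TopLetterNew q₀ hq k) (hk : k + 1 ≤ n) :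
    GenAt (towerSys q₀ n) k := by
  classical
  refine ⟨Unit, fun _ => fhQ (k + 1) q₀, fun _ => 1, fun _ => Or.inl ⟨hk, rfl⟩, ?_, ?_⟩
  · rintro F (⟨-, rfl⟩ | ⟨u, hu, rfl⟩) P
    · refine ⟨Finsupp.single () (diagAltm q₀ P), fun _ _ => rfl, ?_⟩
      rw [Finsupp.sum_single_index (by rw [C_0, zero_mul]), mul_one]
      exact sub_C_diagAltm_mem q₀ P
    · refine ⟨0, fun i hi => ?_, ?_⟩
      · simp at hi
      · rw [Finsupp.sum_zero_index, sub_zero]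
        have h := mul_mem_ex0m (C u) (C u⁻¹ * P)
        rwa [← mul_assoc, ← map_mul, mul_inv_cancel₀ hu, map_one, one_mul] at h
  · intro c hc
    have hsum : c.sum (fun _ r => (r : ℝ) * cubeVal (k + 1) 1 (fhQ (k + 1) q₀))
        = ((c () : ℚ) : ℝ) * letter q₀ hq (k + 1) := by
      rw [Finsupp.sum_fintype _ _ (fun _ => by rw [Rat.cast_zero, zero_mul]), Fintype.sum_unique]
      rfl
    rw [hsum] at hc
    have hc' : InSpan q₀ hq k (((c () : ℚ) : ℝ) * letter q₀ hq (k + 1)) := VSpan_towerSys_le q₀ hq k hc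
    by_contra hne
    have hne' : c () ≠ 0 := fun h0 => hne (Finsupp.ext fun _ => h0)
    apply hN
    have h := InSpan.smul q₀ hq (c ())⁻¹ hc'
    rwa [← mul_assoc, ← Rat.cast_mul, inv_mul_cancel₀ hne', Rat.cast_one, one_mul] at h

include hq in
/-- **The tower denominator `q₀ + x₀⋯x_{n-1}` is letter-generic** as soon as each letter
`L_k(q₀)`, `2 ≤ k ≤ n`, is new over the lower ones. [folklore] -/
theorem isGeneric_fhQ (hN : ∀ k, k + 2 ≤ n → TopLetterNew q₀ hq (k + 1)) : IsGeneric (fhQ n q₀) :=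
  ⟨towerSys q₀ n, zeroFree_towerSys q₀ hq, faceClosed_towerSys q₀ hq, Or.inl ⟨le_rfl, rfl⟩,
    fun k hk => genAt_towerSys q₀ hq (hN k hk) hk⟩

/-- Auxiliary step `lettersLinIndep_of_add`: letters Lin Indep of add. [bookkeeping] -/
theorem lettersLinIndep_of_add {j d : ℕ} (h : LettersLinIndep q₀ hq (j + d)) : LettersLinIndep q₀ hq j := by
  induction d with
  | zero => exact h
  | succ d ih => exact ih (lettersLinIndep_mono q₀ hq h)

/-- Auxiliary step `topLetterNew_of_linIndep_le`: top Letter New of lin Indep le. [bookkeeping] -/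
theorem topLetterNew_of_linIndep_le (hL : LettersLinIndep q₀ hq n) {k : ℕ} (hk : k + 2 ≤ n) :
    TopLetterNew q₀ hq (k + 1) := by
  obtain ⟨d, rfl⟩ := Nat.exists_eq_add_of_le hk
  exact topLetterNew_of_linIndep q₀ hq (lettersLinIndep_of_add q₀ hq hL)

include hq in
/-- The tower denominator is letter-generic under §17's input `LettersLinIndep q₀ n`. [folklore] -/
theorem isGeneric_fhQ_of_linIndep (hL : LettersLinIndep q₀ hq n) : IsGeneric (fhQ n q₀) :=
  isGeneric_fhQ q₀ hq fun _ hk => topLetterNew_of_linIndep_le q₀ hq hL hk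

/-- **THEOREM B of §17 re-derived from THEOREM U, and SHARPENED**: the hypothesis is only that the
letters `L_2(q₀), …, L_n(q₀)` are each new over the lower ones — nothing is asked about `L_1(q₀)`
(dimension `≤ 1` is Baker-in-the-tree). [folklore] -/
theorem fh_decided_of_topLettersNew (hN : ∀ k, k + 2 ≤ n → TopLetterNew q₀ hq (k + 1))
    (P : MvPolynomial (Fin n) ℚ) (h0 : fhV q₀ hq n P = 0) : KZ.of (fhR q₀ hq n P).rep ∈ KZ.relations :=
  rep_mem_relations_of_generic (towerSys q₀ n) (zeroFree_towerSys q₀ hq) (faceClosed_towerSys q₀ hq)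
    (fun k hk => genAt_towerSys q₀ hq (hN k hk) hk) (fhR q₀ hq n P) (Or.inl ⟨le_rfl, rfl⟩) h0

/-- THEOREM B of §17 (`fh_decided`) as an instance of THEOREM U. [folklore] -/
theorem fh_decided_via_U (hL : LettersLinIndep q₀ hq n) (P : MvPolynomial (Fin n) ℚ)
    (h0 : fhV q₀ hq n P = 0) : KZ.of (fhR q₀ hq n P).rep ∈ KZ.relations :=
  fh_decided_of_topLettersNew q₀ hq (fun _ hk => topLetterNew_of_linIndep_le q₀ hq hL hk) P h0

/-- **The dimension-2 census class `Q = q₀ + xy`, FULLY DECIDED from the newness of the dilogarithm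
alone** (`N = 0`, every numerator): `L_2(q₀) ∉ ℚ + ℚ·log((q₀+1)/q₀)` — a theorem for integers
`q₀ ≥ 5 ∨ q₀ ≤ −6` [Hata 1993; Rhin–Viola 2019 §5] — suffices (§17 asked `LettersLinIndep q₀ 2`,
i.e. also the irrationality of `log((q₀+1)/q₀)`). [folklore] -/
theorem fh_two_decided_of_dilog_new (hN : TopLetterNew q₀ hq 1) (P : MvPolynomial (Fin 2) ℚ)
    (h0 : fhV q₀ hq 2 P = 0) : KZ.of (fhR q₀ hq 2 P).rep ∈ KZ.relations :=
  fh_decided_of_topLettersNew q₀ hq (n := 2)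
    (fun k hk => by obtain rfl : k = 0 := (by omega); exact hN) P h0

end TowerInstance
/-! ### INSTANCE 2: two-point towers `(q₁ + x₀⋯x_{k-1})(q₂ + x₀⋯x_{k-1})` — BEYOND §17

The denominators `Q = (q₁ + u)(q₂ + u)`, `u = x₀⋯x_{m-1}`, `q₁ ≠ q₂`, are full rank, NOT exact and NOT
towers; their letters at level `k` are the PAIR `1/(q₁+u), 1/(q₂+u)` (partial fractions), with values
`L_k(q₁) = −Li_k(−1/q₁)`, `L_k(q₂)`; SPAN is §9 twice plus the functoriality of `Ex0m` under enlarging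
the polar divisor (`mul_mem_ex0m_mul`); INDEP is the joint newness of the two top letters over
`ℚ + Σ_{j<k} (ℚ·L_j(q₁) + ℚ·L_j(q₂))` — in print for large heights: David–Hirata-Kohno–Kawashima,
arXiv:2010.09167, Thm. 1 / Cor. 1 p. 6–7 (`1, Li_s(α₁/β), Li_s(α₂/β)`, `s ≤ r`, linearly independent
over `ℚ` for `β ≥ β₀(r; α₁, α₂)`; Example 2 p. 37: `log b > 1908.6`, `r = m = 10`). -/

section TwoPointInstance

variable {n : ℕ} (q₁ q₂ : ℚ) (h₁ : 0 < q₁ ∨ q₁ < -1) (h₂ : 0 < q₂ ∨ q₂ < -1)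

/-- `Ex0m` is functorial under enlarging the polar divisor: `P ∈ Ex0m Q → P·R ∈ Ex0m (Q·R)`
(`Σ ∂_j(G_j/Q) = Σ ∂_j(G_j R/(Q R))`). [folklore] -/
theorem mul_mem_ex0m_mul {k : ℕ} {Q P : MvPolynomial (Fin k) ℚ} (R : MvPolynomial (Fin k) ℚ)
    (h : P ∈ Ex0m Q) : P * R ∈ Ex0m (Q * R) := by
  obtain ⟨G, hG⟩ := mem_ex0m_iff.mp h
  refine mem_ex0m_iff.mpr ⟨fun j => G j * R, ?_⟩
  have key : ∀ j, exS (Q * R) j (G j * R) = R * R * exS Q j (G j) := fun j => by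
    simp only [exS, Derivation.leibniz, smul_eq_mul, Nat.cast_zero, zero_add, map_one, one_mul]
    ring
  simp_rw [key]
  rw [← Finset.mul_sum, ← hG]
  ring

/-- THE TWO-POINT SYSTEM: the products `(q₁ + x₀⋯x_{k-1})(q₂ + x₀⋯x_{k-1})` (`k ≤ n`) and the non-zero
constants. (folklore) -/
def twoSys (n : ℕ) (k : ℕ) : Set (MvPolynomial (Fin k) ℚ) :=
  {F | (k ≤ n ∧ F = fhQ k q₁ * fhQ k q₂) ∨ ∃ u : ℚ, u ≠ 0 ∧ F = C u}

include h₁ h₂ in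
/-- Auxiliary step `zeroFree_twoSys`: zero Free two Sys. [bookkeeping] -/
theorem zeroFree_twoSys : ZeroFree (twoSys q₁ q₂ n) := by
  rintro k F (⟨-, rfl⟩ | ⟨u, hu, rfl⟩) x hx
  · rw [map_mul]; exact mul_ne_zero (fhQ_ne_zero_of q₁ h₁ x hx) (fhQ_ne_zero_of q₂ h₂ x hx)
  · rw [MvPolynomial.aeval_C, eq_ratCast]; exact_mod_cast hu

include h₁ h₂ in
/-- Auxiliary step `faceClosed_twoSys`: face Closed two Sys. [bookkeeping] -/
theorem faceClosed_twoSys : FaceClosed (twoSys q₁ q₂ n) := by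
  rintro k F (⟨hk, rfl⟩ | ⟨u, hu, rfl⟩) j c hc
  · rw [map_mul, bind₁_insX_fhQ, bind₁_insX_fhQ]
    rcases hc with rfl | rfl
    · refine Or.inr ⟨q₁ * q₂, mul_ne_zero (q₀_ne_zero_rat q₁ h₁) (q₀_ne_zero_rat q₂ h₂), ?_⟩
      rw [C_0, zero_mul, add_zero, add_zero, ← map_mul]
    · refine Or.inl ⟨Nat.le_of_succ_le hk, ?_⟩
      rw [C_1, one_mul, ← fhQ_eq, ← fhQ_eq]
  · exact Or.inr ⟨u, hu, by rw [bind₁_C_right]⟩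

include h₁ h₂ in
/-- Auxiliary step `two_ne_zero_cube`: two ne zero cube. [bookkeeping] -/
theorem two_ne_zero_cube {k : ℕ} (x : Fin k → ℝ) (hx : x ∈ KZ.cube k) :
    aeval x (fhQ k q₁ * fhQ k q₂) ≠ 0 := by
  rw [map_mul]; exact mul_ne_zero (fhQ_ne_zero_of q₁ h₁ x hx) (fhQ_ne_zero_of q₂ h₂ x hx)

/-- `[ [0,1]^k, P/((q₁+u)(q₂+u)) ]`. (folklore) -/
def twoR (k : ℕ) (P : MvPolynomial (Fin k) ℚ) : RFun k :=
  ⟨P, fhQ k q₁ * fhQ k q₂, two_ne_zero_cube q₁ q₂ h₁ h₂⟩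

/-- Partial fractions on the values: `∫ P/((q₁+u)(q₂+u)) = (∫ P/(q₁+u) − ∫ P/(q₂+u))/(q₂ − q₁)`. [folklore] -/
theorem value_twoR (hne : q₁ ≠ q₂) (k : ℕ) (P : MvPolynomial (Fin k) ℚ) :
    (twoR q₁ q₂ h₁ h₂ k P).rep.value
      = (((q₂ - q₁)⁻¹ : ℚ) : ℝ) * fhV q₁ h₁ k P + ((-(q₂ - q₁)⁻¹ : ℚ) : ℝ) * fhV q₂ h₂ k P := by
  rw [← fhV_C_mul, ← fhV_C_mul, fhV, fhV, ← value_add]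
  refine value_eq_of_fn_eq fun x hx => ?_
  have hf₁ : aeval x (fhQ k q₁) ≠ 0 := fhQ_ne_zero_of q₁ h₁ x hx
  have hf₂ : aeval x (fhQ k q₂) ≠ 0 := fhQ_ne_zero_of q₂ h₂ x hx
  have hd : aeval x (fhQ k q₂) - aeval x (fhQ k q₁) = (((q₂ - q₁) : ℚ) : ℝ) := by
    rw [aeval_fhQ, aeval_fhQ, Rat.cast_sub]; ring
  have ha : ((((q₂ - q₁)⁻¹ : ℚ)) : ℝ) * (((q₂ - q₁ : ℚ)) : ℝ) = 1 := by
    rw [← Rat.cast_mul, inv_mul_cancel₀ (sub_ne_zero.2 (Ne.symm hne)), Rat.cast_one]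
  rw [RFun.fn_add hx, RFun.fn_apply, RFun.fn_apply, RFun.fn_apply]
  show aeval x P / aeval x (fhQ k q₁ * fhQ k q₂)
    = aeval x (C (q₂ - q₁)⁻¹ * P) / aeval x (fhQ k q₁) + aeval x (C (-(q₂ - q₁)⁻¹) * P) / aeval x (fhQ k q₂)
  rw [map_mul, map_mul, map_mul, MvPolynomial.aeval_C, MvPolynomial.aeval_C, eq_ratCast, eq_ratCast,
    Rat.cast_neg, neg_mul, neg_div, ← sub_eq_add_neg, div_sub_div _ _ hf₁ hf₂]
  congr 1
  calc aeval x P = (((q₂ - q₁)⁻¹ : ℚ) : ℝ) * (aeval x (fhQ k q₂) - aeval x (fhQ k q₁)) * aeval x P := by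
          rw [hd, ha, one_mul]
    _ = _ := by ring

/-- Every value of dimension `≤ k` over the two-point system lies in
`ℚ + Σ_{j ≤ k} (ℚ·L_j(q₁) + ℚ·L_j(q₂))`. [folklore] -/
theorem VSpan_twoSys_le (hne : q₁ ≠ q₂) (k : ℕ) :
    VSpan (twoSys q₁ q₂ n) k ≤ inSpanSub q₁ h₁ k ⊔ inSpanSub q₂ h₂ k := by
  rw [VSpan, Submodule.span_le]
  rintro v ⟨j, P, F, hjk, hF, rfl⟩
  rcases hF with ⟨-, rfl⟩ | ⟨u, hu, rfl⟩
  · have : cubeVal j P (fhQ j q₁ * fhQ j q₂) = (twoR q₁ q₂ h₁ h₂ j P).rep.value := rfl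
    rw [this, value_twoR q₁ q₂ h₁ h₂ hne]
    refine add_mem (Submodule.mem_sup_left ?_) (Submodule.mem_sup_right ?_)
    · exact InSpan.mono_le q₁ h₁ hjk (InSpan.smul q₁ h₁ _ (fhV_inSpan q₁ h₁ j P))
    · exact InSpan.mono_le q₂ h₂ hjk (InSpan.smul q₂ h₂ _ (fhV_inSpan q₂ h₂ j P))
  · have hz : ∀ x ∈ KZ.cube j, aeval x (C u : MvPolynomial (Fin j) ℚ) ≠ 0 := fun x _ => by
      rw [MvPolynomial.aeval_C, eq_ratCast]; exact_mod_cast hu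
    obtain ⟨r, hr⟩ := exists_rat_value_of_den_C (⟨P, C u, hz⟩ : RFun j) rfl
    have : cubeVal j P (C u) = (⟨P, C u, hz⟩ : RFun j).rep.value := rfl
    rw [this, hr]
    exact Submodule.mem_sup_left (InSpan.mono_le q₁ h₁ hjk (inSpan_rat q₁ h₁ r))

/-- **SPAN for the two-point product** (partial fractions + §9 twice + `mul_mem_ex0m_mul`):
`P ≡ (Λ_{q₁}(P)/(q₂−q₁))·(q₂+u) − (Λ_{q₂}(P)/(q₂−q₁))·(q₁+u)  (mod Ex0m ((q₁+u)(q₂+u)))`. [folklore] -/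
theorem span_two {k : ℕ} (hne : q₁ ≠ q₂) (P : MvPolynomial (Fin (k + 1)) ℚ) :
    P - (C ((q₂ - q₁)⁻¹ * diagAltm q₁ P) * fhQ (k + 1) q₂
        + C (-((q₂ - q₁)⁻¹ * diagAltm q₂ P)) * fhQ (k + 1) q₁)
      ∈ Ex0m (fhQ (k + 1) q₁ * fhQ (k + 1) q₂) := by
  have hF : fhQ (k + 1) q₂ - fhQ (k + 1) q₁ = C (q₂ - q₁) := by rw [fhQ_eq, fhQ_eq, map_sub]; ring
  have e₁ : (P - C (diagAltm q₁ P)) * fhQ (k + 1) q₂ ∈ Ex0m (fhQ (k + 1) q₁ * fhQ (k + 1) q₂) :=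
    mul_mem_ex0m_mul _ (sub_C_diagAltm_mem q₁ P)
  have e₂ : (P - C (diagAltm q₂ P)) * fhQ (k + 1) q₁ ∈ Ex0m (fhQ (k + 1) q₁ * fhQ (k + 1) q₂) := by
    rw [mul_comm (fhQ (k + 1) q₁)]
    exact mul_mem_ex0m_mul _ (sub_C_diagAltm_mem q₂ P)
  have e := Submodule.smul_mem _ (q₂ - q₁)⁻¹ (sub_mem e₁ e₂)
  rw [MvPolynomial.smul_eq_C_mul] at e
  have ha : C (q₂ - q₁)⁻¹ * C (q₂ - q₁) = (1 : MvPolynomial (Fin (k + 1)) ℚ) := by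
    rw [← map_mul, inv_mul_cancel₀ (sub_ne_zero.2 (Ne.symm hne)), map_one]
  convert e using 1
  calc P - (C ((q₂ - q₁)⁻¹ * diagAltm q₁ P) * fhQ (k + 1) q₂
          + C (-((q₂ - q₁)⁻¹ * diagAltm q₂ P)) * fhQ (k + 1) q₁)
        = C (q₂ - q₁)⁻¹ * C (q₂ - q₁) * P - (C ((q₂ - q₁)⁻¹ * diagAltm q₁ P) * fhQ (k + 1) q₂
          + C (-((q₂ - q₁)⁻¹ * diagAltm q₂ P)) * fhQ (k + 1) q₁) := by rw [ha, one_mul]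
    _ = C (q₂ - q₁)⁻¹ * (P * (fhQ (k + 1) q₂ - fhQ (k + 1) q₁))
          - (C ((q₂ - q₁)⁻¹ * diagAltm q₁ P) * fhQ (k + 1) q₂
          + C (-((q₂ - q₁)⁻¹ * diagAltm q₂ P)) * fhQ (k + 1) q₁) := by rw [hF]; ring
    _ = _ := by rw [map_neg, map_mul, map_mul]; ring

/-- **INPUT (two-point letters jointly new).** `c₁·L_{k+1}(q₁) + c₂·L_{k+1}(q₂) ∈ ℚ + Σ_{j≤k}(ℚ L_j(q₁) +
ℚ L_j(q₂)) ⟹ c₁ = c₂ = 0`. Implied by the linear independence over `ℚ` of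
`1, Li_s(−1/q₁), Li_s(−1/q₂)` (`s ≤ k+1`) — a THEOREM for `q₂/q₁ ∈ ℚ` fixed and height large
[David–Hirata-Kohno–Kawashima, arXiv:2010.09167, Cor. 1]. (cite arXiv:2010.09167, Corollary 1) -/
def TwoPointNew (k : ℕ) : Prop :=
  ∀ c₁ c₂ : ℚ, (c₁ : ℝ) * letter q₁ h₁ (k + 1) + (c₂ : ℝ) * letter q₂ h₂ (k + 1)
      ∈ inSpanSub q₁ h₁ k ⊔ inSpanSub q₂ h₂ k → c₁ = 0 ∧ c₂ = 0

end TwoPointInstance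
end LetterCriterion
end Summit.KontsevichZagierPeriods.RootDecompRationalCubeDichotomy.Rung26322.RankDescent
end
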